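import Mathlib
import HarnessLib
import Summits.HubbardSuperconductivity.HubbardSuperconductivity.Theorems.KLProgrammeThinShellBoxMomentumCount
import Summits.HubbardSuperconductivity.HubbardSuperconductivity.Theorems.KLProgrammeKLRegimeSectorSliceGramFat
import Summits.HubbardSuperconductivity.HubbardSuperconductivity.Theorems.KLProgrammeKLRegimeSectorGramHalfNormSum

/-!
# Route `KLProgramme` — ENGINE child gen 8 (stmt-HubbardSuperconductivity-20437 `KLRegimeEngineV17F2`), skeleton v2 class #3 witness input GAP L2-c:
# the ANNULUS COUNT of one fat sector multiplier and the β-UNIFORM entry bound of the fat-sectorised slice / soft lines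
# (cell gate-hubbard-kl, seat hubbard-kl-k3c2-p2 g9, value/(T) lane; companion of …SectorSliceGramFat (k3c2-p3) and …SoftCovSectorEntrySharp (g8))

For the fat family `Ft = bgmFatMultiplier L M e₀ β (nambuXiCT L μ K) (m+1)` on an admissible frame (the `μ`-frame data `B, A, z` of the fat pack):

* §1 `coord_floor_of_le_norm_gradient` — a gradient floor `‖∇f‖ ≥ g₀` of `f` on `EuclideanSpace ℝ (Fin 2)` is a COORDINATE floor
  `g₀/√2 ≤ |∂₀(f∘toLp)| ∨ g₀/√2 ≤ |∂₁(f∘toLp)|` on `Fin 2 → ℝ` (the currency of `card_filter_shell_box_le`);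
* §2 **`card_annulus_bgmFat_le`** — `#{k : Ft_ω(k) ≠ 0, r/2 < ρ_K(k) ≤ r} ≤ (rβ/π + 3)·2(ρ_f L/π + 1)(8π(4+4A)/λ + 1)(4rL/(πλ) + 2)` for
  `0 < r ≤ Λ_m`, `ρ_K(k) = √(ω_k² + e_K(k⃗)²)`, `ρ_f` = the cell radius of `card_support_bgmFat_le`, given a coordinate-gradient floor `λ` of the
  frame band on the shell `{|e_K| ≤ Λ_m}`: time window × the SAGITTA-FREE thin-shell-in-a-box count (…ThinShellBoxMomentumCount) — area `r × ρ_f`;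
  **`card_annulus_bgmFat_le_sq`** — `≤ C_ann·r²` for ALL `0 < r ≤ Λ_m`, `C_ann = (8β/π)(ρ_f L/π + 1)(8π(4+4A)/λ + 1)(4L/(πλ) + 2β/π)` (below the
  first Matsubara frequency `π/β` the annulus is EMPTY);
* §3 **`norm_entry_sliceCT_bgmFat_sharp_le`** — for every slice `0 < Λ ≤ Λ′ ≤ Λ_m`:
  `‖(S(Ft)ᵀ·C^K_{(Λ,Λ′]}·S(Ft)) Y Y′‖ ≤ ‖(βL²)⁻¹‖²·(4βL²·C_ann·Λ′)` — NO `Λ′/Λ` (g8's `norm_entry_sectorSub_sliceCT_le_of_annulusCount`), and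
  **`norm_sq_sectorGramF/G_sliceCT_bgmFat_sharp_le`** — the same number bounds the Gram half-norms `‖F_Y‖², ‖G_Y‖²` (BGM (2.80)).

The regime corollary under the stub binders (`FrameOK` ⇒ `λ = 1/(2√2)`, `ρ_f ≤ c_ρπ/2^{m+1}`, `L ≥ β²` ⇒ entry `≤ Cκ·e₀·8^{-(m+1)}` for the SOFT
covariance, p5's l.3059 shape WITHOUT `Λ_n/Λ_{n_β+1}`) is the companion file …SectorSliceGramSoftSharp.
Everything is proved; no definitions, no named facts. [cite: BenfattoGiulianiMastropietro2006, §2.7 (2.66)–(2.67), §2.8 (2.80)]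
-/

noncomputable section

namespace Summit.HubbardSuperconductivity.HubbardSuperconductivity.Theorems.TorusFourierL2

set_option linter.dupNamespace false -- summit = problem name (single-conjunct summit), D-0017

open Set Finset Literature.MathematicalPhysics.QuantumLattice Literature.MathematicalPhysics.QuantumLattice.BandSectorCounting
open Literature.MathematicalPhysics.QuantumLattice.FermiRG Literature.Probability.LatticeModels Literature.Analysis.SpecialFunctions
open Summit.HubbardSuperconductivity.HubbardSuperconductivity.Theorems.DispersionFlow
open Summit.HubbardSuperconductivity.HubbardSuperconductivity.Theorems.KLRegimeSplit
open Summit.HubbardSuperconductivity.HubbardSuperconductivity.Theorems.KLProgrammeLegKernels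
open Summit.HubbardSuperconductivity.HubbardSuperconductivity.Theorems.PerturbedFermiCurve
open scoped Real Nat

/-! ### §1 A gradient floor is a coordinate-gradient floor -/

/-- **Coordinate floor from a gradient floor**: if `‖∇f(toLp p)‖ ≥ g₀ > 0` then one of the two partial derivatives of `f ∘ toLp` at `p`
is `≥ g₀/√2` in absolute value. [folklore] -/
theorem coord_floor_of_le_norm_gradient {f : EuclideanSpace ℝ (Fin 2) → ℝ} (hf : Differentiable ℝ f) {g₀ : ℝ} (hg₀ : 0 < g₀)
    (p : Fin 2 → ℝ) (h : g₀ ≤ ‖gradient f (WithLp.toLp 2 p)‖) :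
    g₀ / Real.sqrt 2 ≤ |fderiv ℝ (fun q : Fin 2 → ℝ => f (WithLp.toLp 2 q)) p (Pi.single 0 1)| ∨
      g₀ / Real.sqrt 2 ≤ |fderiv ℝ (fun q : Fin 2 → ℝ => f (WithLp.toLp 2 q)) p (Pi.single 1 1)| := by
  set Ψ : (Fin 2 → ℝ) ≃L[ℝ] EuclideanSpace ℝ (Fin 2) := (EuclideanSpace.equiv (Fin 2) ℝ).symm with hΨdef
  have hΨq : ∀ q : Fin 2 → ℝ, Ψ q = WithLp.toLp 2 q := fun q => by simp [hΨdef, EuclideanSpace.equiv]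
  have hcomp : (fun q : Fin 2 → ℝ => f (WithLp.toLp 2 q)) = f ∘ (Ψ : (Fin 2 → ℝ) →L[ℝ] EuclideanSpace ℝ (Fin 2)) := by
    funext q; simp [hΨq]
  have hfd : fderiv ℝ (fun q : Fin 2 → ℝ => f (WithLp.toLp 2 q)) p =
      (fderiv ℝ f (Ψ p)).comp (Ψ : (Fin 2 → ℝ) →L[ℝ] EuclideanSpace ℝ (Fin 2)) := by
    rw [hcomp]; exact Ψ.comp_right_fderiv
  have hpart : ∀ v : Fin 2 → ℝ, fderiv ℝ (fun q : Fin 2 → ℝ => f (WithLp.toLp 2 q)) p v = inner ℝ (gradient f (Ψ p)) (Ψ v) := by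
    intro v
    rw [hfd, ContinuousLinearMap.comp_apply, gradient, InnerProductSpace.toDual_symm_apply]
    rfl
  have hΨ0 : Ψ (Pi.single 0 1) = EuclideanSpace.single 0 (1 : ℝ) := by
    rw [hΨq]; ext i; fin_cases i <;> simp
  have hΨ1 : Ψ (Pi.single 1 1) = EuclideanSpace.single 1 (1 : ℝ) := by
    rw [hΨq]; ext i; fin_cases i <;> simp
  have hd0 : fderiv ℝ (fun q : Fin 2 → ℝ => f (WithLp.toLp 2 q)) p (Pi.single 0 1) = gradient f (Ψ p) 0 := by
    rw [hpart, hΨ0, EuclideanSpace.inner_single_right]; simp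
  have hd1 : fderiv ℝ (fun q : Fin 2 → ℝ => f (WithLp.toLp 2 q)) p (Pi.single 1 1) = gradient f (Ψ p) 1 := by
    rw [hpart, hΨ1, EuclideanSpace.inner_single_right]; simp
  have hΨp : Ψ p = WithLp.toLp 2 p := hΨq p
  rw [hd0, hd1, hΨp]
  by_contra hcon
  push Not at hcon
  obtain ⟨h0, h1⟩ := hcon
  have hs : (g₀ / Real.sqrt 2) ^ 2 = g₀ ^ 2 / 2 := by rw [div_pow, Real.sq_sqrt (by norm_num)]
  have hsq : ‖gradient f (WithLp.toLp 2 p)‖ ^ 2 = (gradient f (WithLp.toLp 2 p) 0) ^ 2 + (gradient f (WithLp.toLp 2 p) 1) ^ 2 := by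
    rw [EuclideanSpace.real_norm_sq_eq, Fin.sum_univ_two]
  have hlt0 : (gradient f (WithLp.toLp 2 p) 0) ^ 2 < g₀ ^ 2 / 2 := by
    rw [← hs, ← sq_abs]; exact pow_lt_pow_left₀ h0 (abs_nonneg _) two_ne_zero
  have hlt1 : (gradient f (WithLp.toLp 2 p) 1) ^ 2 < g₀ ^ 2 / 2 := by
    rw [← hs, ← sq_abs]; exact pow_lt_pow_left₀ h1 (abs_nonneg _) two_ne_zero
  have : g₀ ^ 2 ≤ ‖gradient f (WithLp.toLp 2 p)‖ ^ 2 := pow_le_pow_left₀ hg₀.le h 2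
  have _ := hf
  linarith

/-! ### §2 The annulus count of one fat multiplier -/

section FatAnnulus

open Classical

variable {L M : ℕ} [NeZero L] {a b : ℝ} (B : BandBounds a b) {K : TrigPolyC4v} {A : ℝ}
  (hA : ∀ p : Momentum, ∀ j ≤ 2, ‖iteratedFDeriv ℝ j (frameShift K) p‖ ≤ A) (hADt : 2 * A < B.Dtmin)
  {μ e₀ β : ℝ} (he : 0 < e₀) (hgap : e₀ + A < -μ) (hlo : a ≤ μ - A - e₀) (hhi : μ + A + e₀ ≤ b) (hβ : 0 < β) (m : ℕ)
  {lam : ℝ} (hlam : 0 < lam)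
  (hgradK : ∀ p : Fin 2 → ℝ, |frameLevel μ K (WithLp.toLp 2 p)| ≤ klScale e₀ m →
    lam ≤ |fderiv ℝ (fun q : Fin 2 → ℝ => frameLevel μ K (WithLp.toLp 2 q)) p (Pi.single 0 1)| ∨
      lam ≤ |fderiv ℝ (fun q : Fin 2 → ℝ => frameLevel μ K (WithLp.toLp 2 q)) p (Pi.single 1 1)|)

include B hA hADt he hgap hlo hhi hβ hlam hgradK in
/-- **Annulus count of ONE fat multiplier** (uniform in the sector): for `0 < r ≤ Λ_m`,
`#{k : Ft_ω(k) ≠ 0, r/2 < ρ_K(k) ≤ r} ≤ (rβ/π + 3)·2(ρ_f L/π + 1)·(8π(4+4A)/λ + 1)·(4rL/(πλ) + 2)`, `ρ_f` the cell radius of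
`card_support_bgmFat_le` — time window `|ω| ≤ r` × thin shell `|e_K| ≤ r` inside the sup-norm box of radius `ρ_f` around `p_F(θ_{m+1,ω})`,
the latter counted along coordinate fibres (`card_filter_shell_box_le`): area `r·ρ_f`, no sagitta. [cite: BenfattoGiulianiMastropietro2006, §2.7 (2.66)] -/
theorem card_annulus_bgmFat_le (ω : Fin (sectorCount (m + 1))) {r : ℝ} (hr : 0 < r) (hrm : r ≤ klScale e₀ m) :
    ((((univ : Finset (FreqMomentum L M)).filter fun k => bgmFatMultiplier L M e₀ β (nambuXiCT L μ K) (m + 1) ω k ≠ 0).filter fun k =>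
        r / 2 < Real.sqrt (matsubaraFreq β M k.1 ^ 2 + nambuXiCT L μ K k.2 ^ 2) ∧
          Real.sqrt (matsubaraFreq β M k.1 ^ 2 + nambuXiCT L μ K k.2 ^ 2) ≤ r).card : ℝ) ≤
      (r * β / π + 3) *
        (2 * (((klScale e₀ m + B.smax * B.Dtmin * (3 * sectorWidth (m + 1) / 4)) / (B.Dtmin - 2 * A) +
              π * Real.sqrt 2 * (1 + (4 + 2 * A) / (B.Dtmin - 2 * A)) * sectorWidth (m + 1)) * L / π + 1) *
          ((8 * π * (4 + 4 * A) / lam + 1) * (4 * r * L / (π * lam) + 2))) := by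
  classical
  have hlo' : a ≤ μ - A := by linarith only [hlo, he]
  have hhi' : μ + A ≤ b := by linarith only [hhi, he]
  have hΛ := klScale_le_e0 he.le m
  have hA0 : 0 ≤ A := (norm_nonneg _).trans (hA 0 0 (by norm_num))
  have hDt : 0 < B.Dtmin - 2 * A := by linarith only [hADt]
  set ρ₀ : ℝ := (klScale e₀ m + B.smax * B.Dtmin * (3 * sectorWidth (m + 1) / 4)) / (B.Dtmin - 2 * A) with hρ₀
  set δF : ℝ := π * Real.sqrt 2 * (1 + (4 + 2 * A) / (B.Dtmin - 2 * A)) * sectorWidth (m + 1) with hδF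
  have hρ0 : 0 ≤ ρ₀ + δF := by
    have := B.smax_pos; have := B.Dtmin_pos; have := sectorWidth_pos (m + 1)
    have h0 : 0 < klScale e₀ m := by rw [klScale]; positivity
    positivity
  set pF : Fin 2 → ℝ := klFermiPoint μ K (sectorCenter (m + 1) (ω : ℕ)) with hpF
  set eK : (Fin 2 → ℝ) → ℝ := fun p => frameLevel μ K (WithLp.toLp 2 p) with heK
  set pt : TorusSite 2 L → (Fin 2 → ℝ) := fun k j => 2 * π * (((k j).valMinAbs : ℤ) : ℝ) / L with hpt
  have hpt_eq : ∀ k : TorusSite 2 L, pt k = torusCentredMomentum L k := by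
    intro k; rw [torusCentredMomentum_eq_valMinAbs]; funext j; simp only [hpt]; ring
  -- the two one-variable predicates
  set P : MatsubaraIdx M → Prop := fun i => |matsubaraFreq β M i| ≤ r with hP
  set Q : TorusSite 2 L → Prop := fun k => |eK (pt k)| ≤ r ∧ ‖pt k - pF‖ ≤ ρ₀ + δF with hQ
  -- the annulus set is inside `P × Q`
  have hsub : (((univ : Finset (FreqMomentum L M)).filter fun k => bgmFatMultiplier L M e₀ β (nambuXiCT L μ K) (m + 1) ω k ≠ 0).filter fun k =>
        r / 2 < Real.sqrt (matsubaraFreq β M k.1 ^ 2 + nambuXiCT L μ K k.2 ^ 2) ∧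
          Real.sqrt (matsubaraFreq β M k.1 ^ 2 + nambuXiCT L μ K k.2 ^ 2) ≤ r) ⊆
      (univ : Finset (FreqMomentum L M)).filter fun k => P k.1 ∧ Q k.2 := by
    intro k hk
    rw [mem_filter, mem_filter] at hk
    obtain ⟨⟨-, hFt⟩, -, hρr⟩ := hk
    have hω : |matsubaraFreq β M k.1| ≤ r := by
      refine le_trans ?_ hρr
      rw [← Real.sqrt_sq_eq_abs]
      exact Real.sqrt_le_sqrt (by nlinarith [sq_nonneg (nambuXiCT L μ K k.2)])
    have he' : |nambuXiCT L μ K k.2| ≤ r := by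
      refine le_trans ?_ hρr
      rw [← Real.sqrt_sq_eq_abs]
      exact Real.sqrt_le_sqrt (by nlinarith [sq_nonneg (matsubaraFreq β M k.1)])
    have heKk : eK (pt k.2) = nambuXiCT L μ K k.2 := by
      simp only [heK]; rw [hpt_eq, ← nambuXiCT_eq_frameLevel L μ K k.2]
    rw [mem_filter]
    refine ⟨mem_univ _, hω, ?_, ?_⟩
    · rw [heKk]; exact he'
    · -- the cell: angular support ⇒ neighbour sector ⇒ `frameBand_cell` ⇒ triangle with the neighbour's Fermi point
      obtain ⟨a', ha', hζ⟩ := bgmFat_support_angle (μ := μ) (e₀ := e₀) (β := β) m ω k hFt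
      have hang : momentumAngle L k.2 = polarAngle (pt k.2) := by rw [hpt_eq]; rfl
      rw [hang] at hζ
      have hsq : ∀ i, |pt k.2 i| ≤ π + 0 := fun i => by rw [add_zero, hpt_eq]; exact abs_torusCentredMomentum_le_pi L k.2 i
      have hshell : |frameLevel μ K (WithLp.toLp 2 (pt k.2))| ≤ klScale e₀ m := by
        have : eK (pt k.2) = frameLevel μ K (WithLp.toLp 2 (pt k.2)) := rfl
        rw [← this, heKk]; exact he'.trans hrm
      have hcell := frameBand_cell B hA hADt (μ := μ) (Λ := klScale e₀ m) (z := 0) le_rfl zero_le_one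
        (by linarith) (by linarith) (by linarith) (m + 1) a' hsq hshell hζ
      have hnbr := norm_klFermiPoint_fatNbr_sub_le B hA hlo' hhi' hADt (m + 1) (ω : ℕ) ha'
      calc ‖pt k.2 - pF‖ = ‖(pt k.2 - klFermiPoint μ K (sectorCenter (m + 1) a')) +
            (klFermiPoint μ K (sectorCenter (m + 1) a') - pF)‖ := by congr 1; abel
        _ ≤ ρ₀ + δF := (norm_add_le _ _).trans (add_le_add hcell hnbr)
  -- the product count
  have hprod := card_filter_freqMomentum_eq (L := L) (M := M) P Q
  -- the time window
  have hT : ((((univ : Finset (MatsubaraIdx M)).filter P).card : ℝ)) ≤ r * β / π + 3 :=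
    card_filter_matsubaraFreq_le hβ hr.le _ fun i hi => (mem_filter.1 hi).2
  -- the thin shell inside the box, along fibres
  have hX : ((((univ : Finset (TorusSite 2 L)).filter Q).card : ℝ)) ≤
      2 * ((ρ₀ + δF) * L / π + 1) * ((8 * π * (4 + 4 * A) / lam + 1) * (4 * r * L / (π * lam) + 2)) := by
    refine card_filter_shell_box_le L (contDiff_frameBand μ K) (by positivity : (0 : ℝ) < 4 + 4 * A)
      (norm_iteratedFDeriv_two_frameBand_le hA μ) hr.le hlam hρ0 pF _ (fun k hk => (mem_filter.1 hk).2) fun k hk => ?_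
    have hk' := (mem_filter.1 hk).2.1
    exact hgradK (pt k) (hk'.trans hrm)
  calc _ ≤ ((((univ : Finset (FreqMomentum L M)).filter fun k => P k.1 ∧ Q k.2).card : ℕ) : ℝ) := by exact_mod_cast Finset.card_le_card hsub
    _ = (((univ : Finset (MatsubaraIdx M)).filter P).card : ℝ) * (((univ : Finset (TorusSite 2 L)).filter Q).card : ℝ) := by
        rw [hprod]; push_cast; ring
    _ ≤ _ := mul_le_mul hT hX (Nat.cast_nonneg _) (by positivity)

include B hA hADt he hgap hlo hhi hβ hlam hgradK in
/-- **Annulus count, quadratic form**: `#{k : Ft_ω(k) ≠ 0, r/2 < ρ_K(k) ≤ r} ≤ C_ann·r²` for EVERY `0 < r ≤ Λ_m`, with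
`C_ann = (8β/π)·(ρ_f L/π + 1)·(8π(4+4A)/λ + 1)·(4L/(πλ) + 2β/π)` — for `r < π/β` the annulus holds no fermionic frequency and is empty;
for `r ≥ π/β`, `3 ≤ 3rβ/π` and `2 ≤ 2rβ/π`. [cite: BenfattoGiulianiMastropietro2006, §2.7 (2.66)] -/
theorem card_annulus_bgmFat_le_sq (ω : Fin (sectorCount (m + 1))) {r : ℝ} (hr : 0 < r) (hrm : r ≤ klScale e₀ m) :
    ((((univ : Finset (FreqMomentum L M)).filter fun k => bgmFatMultiplier L M e₀ β (nambuXiCT L μ K) (m + 1) ω k ≠ 0).filter fun k =>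
        r / 2 < Real.sqrt (matsubaraFreq β M k.1 ^ 2 + nambuXiCT L μ K k.2 ^ 2) ∧
          Real.sqrt (matsubaraFreq β M k.1 ^ 2 + nambuXiCT L μ K k.2 ^ 2) ≤ r).card : ℝ) ≤
      (8 * β / π) * (((klScale e₀ m + B.smax * B.Dtmin * (3 * sectorWidth (m + 1) / 4)) / (B.Dtmin - 2 * A) +
              π * Real.sqrt 2 * (1 + (4 + 2 * A) / (B.Dtmin - 2 * A)) * sectorWidth (m + 1)) * L / π + 1) *
          ((8 * π * (4 + 4 * A) / lam + 1) * (4 * L / (π * lam) + 2 * β / π)) * r ^ 2 := by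
  classical
  have hπ := Real.pi_pos
  have hA0 : 0 ≤ A := (norm_nonneg _).trans (hA 0 0 (by norm_num))
  have hDt : 0 < B.Dtmin - 2 * A := by linarith only [hADt]
  set ρ : ℝ := (klScale e₀ m + B.smax * B.Dtmin * (3 * sectorWidth (m + 1) / 4)) / (B.Dtmin - 2 * A) +
      π * Real.sqrt 2 * (1 + (4 + 2 * A) / (B.Dtmin - 2 * A)) * sectorWidth (m + 1) with hρ
  have hρ0 : 0 ≤ ρ := by
    have := B.smax_pos; have := B.Dtmin_pos; have := sectorWidth_pos (m + 1)
    have h0 : 0 < klScale e₀ m := by rw [klScale]; positivity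
    positivity
  set Q₁ : ℝ := 8 * π * (4 + 4 * A) / lam + 1 with hQ₁
  have hQ₁0 : 0 ≤ Q₁ := by rw [hQ₁]; positivity
  have hL : (0 : ℝ) ≤ L := Nat.cast_nonneg _
  rcases lt_or_ge r (π / β) with hsmall | hbig
  · -- empty annulus
    have hempty : (((univ : Finset (FreqMomentum L M)).filter fun k => bgmFatMultiplier L M e₀ β (nambuXiCT L μ K) (m + 1) ω k ≠ 0).filter fun k =>
        r / 2 < Real.sqrt (matsubaraFreq β M k.1 ^ 2 + nambuXiCT L μ K k.2 ^ 2) ∧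
          Real.sqrt (matsubaraFreq β M k.1 ^ 2 + nambuXiCT L μ K k.2 ^ 2) ≤ r) = ∅ := by
      refine filter_eq_empty_iff.2 fun k _ hk => ?_
      have hω := pi_div_le_abs_matsubaraFreq hβ k.1 (M := M)
      have h1 : |matsubaraFreq β M k.1| ≤ Real.sqrt (matsubaraFreq β M k.1 ^ 2 + nambuXiCT L μ K k.2 ^ 2) := by
        rw [← Real.sqrt_sq_eq_abs]
        exact Real.sqrt_le_sqrt (by nlinarith [sq_nonneg (nambuXiCT L μ K k.2)])
      linarith [hk.2]
    rw [hempty, Finset.card_empty, Nat.cast_zero]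
    positivity
  · have h := card_annulus_bgmFat_le (L := L) (M := M) B hA hADt he hgap hlo hhi hβ m hlam hgradK ω hr hrm
    refine h.trans ?_
    have hrβ : π / β ≤ r := hbig
    have h1 : r * β / π + 3 ≤ 4 * (r * β / π) := by
      have : 1 ≤ r * β / π := by
        rw [le_div_iff₀ hπ, one_mul]
        have := mul_le_mul_of_nonneg_right hrβ hβ.le
        rwa [div_mul_cancel₀ _ hβ.ne'] at this
      linarith
    have h2 : 4 * r * L / (π * lam) + 2 ≤ r * (4 * L / (π * lam) + 2 * β / π) := by
      have : 1 ≤ r * β / π := by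
        rw [le_div_iff₀ hπ, one_mul]
        have := mul_le_mul_of_nonneg_right hrβ hβ.le
        rwa [div_mul_cancel₀ _ hβ.ne'] at this
      have e1 : r * (4 * L / (π * lam) + 2 * β / π) = 4 * r * L / (π * lam) + 2 * (r * β / π) := by ring
      rw [e1]; linarith
    have hmid : 0 ≤ 2 * (ρ * L / π + 1) * Q₁ := by positivity
    calc (r * β / π + 3) * (2 * (ρ * L / π + 1) * (Q₁ * (4 * r * L / (π * lam) + 2)))
        = (r * β / π + 3) * (2 * (ρ * L / π + 1) * Q₁) * (4 * r * L / (π * lam) + 2) := by ring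
      _ ≤ (4 * (r * β / π)) * (2 * (ρ * L / π + 1) * Q₁) * (r * (4 * L / (π * lam) + 2 * β / π)) := by
          have ha : 0 ≤ (r * β / π + 3) * (2 * (ρ * L / π + 1) * Q₁) := by positivity
          exact mul_le_mul (mul_le_mul_of_nonneg_right h1 hmid) h2 (by positivity) (by positivity)
      _ = (8 * β / π) * (ρ * L / π + 1) * (Q₁ * (4 * L / (π * lam) + 2 * β / π)) * r ^ 2 := by ring

/-! ### §3 The β-uniform entry bound and Gram half-norms of the fat-sectorised slice -/

include B hA hADt he hgap hlo hhi hβ hlam hgradK in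
/-- **Sector entry bound of the fat-sectorised slice, β-UNIFORM** (no `Λ′/Λ`): for `0 < Λ ≤ Λ′ ≤ Λ_m`,
`‖(S(Ft)ᵀ·C^K_{(Λ,Λ′]}·S(Ft)) Y Y′‖ ≤ ‖(βL²)⁻¹‖²·(4·βL²·C_ann·Λ′)`. [cite: BenfattoGiulianiMastropietro2006, §2.8 (2.80)] -/
theorem norm_entry_sliceCT_bgmFat_sharp_le [NeZero M] {Λ Λ' : ℝ} (hΛ : 0 < Λ) (hΛΛ' : Λ ≤ Λ') (hΛ'm : Λ' ≤ klScale e₀ m)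
    (Y Y' : SpaceTimeIdx L M × SectorLeg (sectorCount (m + 1))) :
    ‖((sectorSubMatrix L M β (bgmFatMultiplier L M e₀ β (nambuXiCT L μ K) (m + 1))).transpose *
        hubbardCovSliceCT L M β μ 0 K Λ Λ' * sectorSubMatrix L M β (bgmFatMultiplier L M e₀ β (nambuXiCT L μ K) (m + 1))) Y Y'‖ ≤
      ‖((1 / (β * (L : ℝ) ^ 2) : ℝ) : ℂ)‖ ^ 2 * (4 * (β * (L : ℝ) ^ 2) *
        ((8 * β / π) * (((klScale e₀ m + B.smax * B.Dtmin * (3 * sectorWidth (m + 1) / 4)) / (B.Dtmin - 2 * A) +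
              π * Real.sqrt 2 * (1 + (4 + 2 * A) / (B.Dtmin - 2 * A)) * sectorWidth (m + 1)) * L / π + 1) *
          ((8 * π * (4 + 4 * A) / lam + 1) * (4 * L / (π * lam) + 2 * β / π))) * Λ') := by
  have hA0 : 0 ≤ A := (norm_nonneg _).trans (hA 0 0 (by norm_num))
  have hDt : 0 < B.Dtmin - 2 * A := by linarith only [hADt]
  have hC : 0 ≤ (8 * β / π) * (((klScale e₀ m + B.smax * B.Dtmin * (3 * sectorWidth (m + 1) / 4)) / (B.Dtmin - 2 * A) +
              π * Real.sqrt 2 * (1 + (4 + 2 * A) / (B.Dtmin - 2 * A)) * sectorWidth (m + 1)) * L / π + 1) *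
          ((8 * π * (4 + 4 * A) / lam + 1) * (4 * L / (π * lam) + 2 * β / π)) := by
    have := B.smax_pos; have := B.Dtmin_pos; have := sectorWidth_pos (m + 1)
    have h0 : 0 < klScale e₀ m := by rw [klScale]; positivity
    positivity
  exact norm_entry_sectorSub_sliceCT_le_of_annulusCount hβ.le μ K hΛ hΛΛ' _ (fun _ _ => norm_bgmFatMultiplier_le_one _ _ _ _ _ _)
    Y Y' hC fun _ hr hrΛ => card_annulus_bgmFat_le_sq (L := L) (M := M) B hA hADt he hgap hlo hhi hβ m hlam hgradK Y.2.1.1 hr (hrΛ.trans hΛ'm)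

include B hA hADt he hgap hlo hhi hβ hlam hgradK in
omit [NeZero L] in
/-- The constant `C_ann` is nonnegative. -/
theorem annulusConst_bgmFat_nonneg : 0 ≤ ((8 * β / π) * (((klScale e₀ m + B.smax * B.Dtmin * (3 * sectorWidth (m + 1) / 4)) / (B.Dtmin - 2 * A) +
              π * Real.sqrt 2 * (1 + (4 + 2 * A) / (B.Dtmin - 2 * A)) * sectorWidth (m + 1)) * L / π + 1) *
          ((8 * π * (4 + 4 * A) / lam + 1) * (4 * L / (π * lam) + 2 * β / π))) := by
  have hA0 : 0 ≤ A := (norm_nonneg _).trans (hA 0 0 (by norm_num))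
  have hDt : 0 < B.Dtmin - 2 * A := by linarith only [hADt]
  have := B.smax_pos; have := B.Dtmin_pos; have := sectorWidth_pos (m + 1)
  have h0 : 0 < klScale e₀ m := by rw [klScale]; positivity
  have _ := hgap; have _ := hlo; have _ := hhi; have _ := hgradK
  positivity

include B hA hADt he hgap hlo hhi hβ hlam hgradK in
/-- **Replica-Gram constant of the fat-sectorised slice, β-UNIFORM**: for `0 < Λ ≤ Λ′ ≤ Λ_m`,
`IsGramBoundedR (S(Ft)ᵀ·C^K_{(Λ,Λ′]}·S(Ft)) √(‖(βL²)⁻¹‖²·(4·βL²·C_ann·Λ′))`. [cite: BenfattoGiulianiMastropietro2006, §2.8 (2.80)] -/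
theorem isGramBoundedR_sliceCT_bgmFat_sharp [NeZero M] {Λ Λ' : ℝ} (hΛ : 0 < Λ) (hΛΛ' : Λ ≤ Λ') (hΛ'm : Λ' ≤ klScale e₀ m) :
    IsGramBoundedR ((sectorSubMatrix L M β (bgmFatMultiplier L M e₀ β (nambuXiCT L μ K) (m + 1))).transpose *
        hubbardCovSliceCT L M β μ 0 K Λ Λ' * sectorSubMatrix L M β (bgmFatMultiplier L M e₀ β (nambuXiCT L μ K) (m + 1)))
      (Real.sqrt (‖((1 / (β * (L : ℝ) ^ 2) : ℝ) : ℂ)‖ ^ 2 * (4 * (β * (L : ℝ) ^ 2) *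
        ((8 * β / π) * (((klScale e₀ m + B.smax * B.Dtmin * (3 * sectorWidth (m + 1) / 4)) / (B.Dtmin - 2 * A) +
              π * Real.sqrt 2 * (1 + (4 + 2 * A) / (B.Dtmin - 2 * A)) * sectorWidth (m + 1)) * L / π + 1) *
          ((8 * π * (4 + 4 * A) / lam + 1) * (4 * L / (π * lam) + 2 * β / π))) * Λ'))) :=
  isGramBoundedR_sectorSub_sliceCT_of_annulusCount hβ.le μ K hΛ hΛΛ' _ (fun _ _ => norm_bgmFatMultiplier_le_one _ _ _ _ _ _)
    (annulusConst_bgmFat_nonneg B hA hADt he hgap hlo hhi hβ m hlam hgradK)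
    fun ω _ hr hrΛ => card_annulus_bgmFat_le_sq (L := L) (M := M) B hA hADt he hgap hlo hhi hβ m hlam hgradK ω hr (hrΛ.trans hΛ'm)

include B hA hADt he hgap hlo hhi hβ hlam hgradK in
/-- **Left Gram half-norm of the fat-sectorised slice, β-UNIFORM**: `‖F_Y‖² ≤ ‖(βL²)⁻¹‖²·(4·βL²·C_ann·Λ′)` (symbol of
`hubbardCovSliceCT_zero_seed`). [cite: BenfattoGiulianiMastropietro2006, §2.8 (2.80)] -/
theorem norm_sq_sectorGramF_sliceCT_bgmFat_sharp_le [NeZero M] {Λ Λ' : ℝ} (hΛ : 0 < Λ) (hΛΛ' : Λ ≤ Λ') (hΛ'm : Λ' ≤ klScale e₀ m)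
    (Y : SpaceTimeIdx L M × SectorLeg (sectorCount (m + 1))) :
    ‖sectorGramF L M β (bgmFatMultiplier L M e₀ β (nambuXiCT L μ K) (m + 1))
        (fun ks => ((hubbardCutoffWeightCT L M β μ K Λ ks.1 : ℂ) - (hubbardCutoffWeightCT L M β μ K Λ' ks.1 : ℂ)) *
          (((β * (L : ℝ) ^ 2 : ℝ) : ℂ) * ((Complex.I * matsubaraFreq β M ks.1.1 + nambuXiCT L μ K ks.1.2) / nambuDenCT L M β μ 0 K ks.1))) Y‖ ^ 2 ≤
      ‖((1 / (β * (L : ℝ) ^ 2) : ℝ) : ℂ)‖ ^ 2 * (4 * (β * (L : ℝ) ^ 2) *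
        ((8 * β / π) * (((klScale e₀ m + B.smax * B.Dtmin * (3 * sectorWidth (m + 1) / 4)) / (B.Dtmin - 2 * A) +
              π * Real.sqrt 2 * (1 + (4 + 2 * A) / (B.Dtmin - 2 * A)) * sectorWidth (m + 1)) * L / π + 1) *
          ((8 * π * (4 + 4 * A) / lam + 1) * (4 * L / (π * lam) + 2 * β / π))) * Λ') :=
  norm_sq_sectorGramF_sliceCT_le_of_annulusCount hβ.le μ K hΛ hΛΛ' _ (fun _ _ => norm_bgmFatMultiplier_le_one _ _ _ _ _ _) Y
    (annulusConst_bgmFat_nonneg B hA hADt he hgap hlo hhi hβ m hlam hgradK)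
    fun _ hr hrΛ => card_annulus_bgmFat_le_sq (L := L) (M := M) B hA hADt he hgap hlo hhi hβ m hlam hgradK Y.2.1.1 hr (hrΛ.trans hΛ'm)

include B hA hADt he hgap hlo hhi hβ hlam hgradK in
/-- **Right Gram half-norm of the fat-sectorised slice, β-UNIFORM**: `‖G_{Y′}‖² ≤ ‖(βL²)⁻¹‖²·(4·βL²·C_ann·Λ′)`.
[cite: BenfattoGiulianiMastropietro2006, §2.8 (2.80)] -/
theorem norm_sq_sectorGramG_sliceCT_bgmFat_sharp_le [NeZero M] {Λ Λ' : ℝ} (hΛ : 0 < Λ) (hΛΛ' : Λ ≤ Λ') (hΛ'm : Λ' ≤ klScale e₀ m)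
    (Y' : SpaceTimeIdx L M × SectorLeg (sectorCount (m + 1))) :
    ‖sectorGramG L M β (bgmFatMultiplier L M e₀ β (nambuXiCT L μ K) (m + 1))
        (fun ks => ((hubbardCutoffWeightCT L M β μ K Λ ks.1 : ℂ) - (hubbardCutoffWeightCT L M β μ K Λ' ks.1 : ℂ)) *
          (((β * (L : ℝ) ^ 2 : ℝ) : ℂ) * ((Complex.I * matsubaraFreq β M ks.1.1 + nambuXiCT L μ K ks.1.2) / nambuDenCT L M β μ 0 K ks.1))) Y'‖ ^ 2 ≤
      ‖((1 / (β * (L : ℝ) ^ 2) : ℝ) : ℂ)‖ ^ 2 * (4 * (β * (L : ℝ) ^ 2) *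
        ((8 * β / π) * (((klScale e₀ m + B.smax * B.Dtmin * (3 * sectorWidth (m + 1) / 4)) / (B.Dtmin - 2 * A) +
              π * Real.sqrt 2 * (1 + (4 + 2 * A) / (B.Dtmin - 2 * A)) * sectorWidth (m + 1)) * L / π + 1) *
          ((8 * π * (4 + 4 * A) / lam + 1) * (4 * L / (π * lam) + 2 * β / π))) * Λ') :=
  norm_sq_sectorGramG_sliceCT_le_of_annulusCount hβ.le μ K hΛ hΛΛ' _ (fun _ _ => norm_bgmFatMultiplier_le_one _ _ _ _ _ _) Y'
    (annulusConst_bgmFat_nonneg B hA hADt he hgap hlo hhi hβ m hlam hgradK)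
    fun _ hr hrΛ => card_annulus_bgmFat_le_sq (L := L) (M := M) B hA hADt he hgap hlo hhi hβ m hlam hgradK Y'.2.1.1 hr (hrΛ.trans hΛ'm)

end FatAnnulus

end Summit.HubbardSuperconductivity.HubbardSuperconductivity.Theorems.TorusFourierL2

end
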